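import Summits.MatrixMultiplication.OmegaCensus.STPPVosperSlackTwoCheckersT
import Summits.MatrixMultiplication.OmegaCensus.STPPVosperSlackTwoTablesZ59
import Summits.MatrixMultiplication.OmegaCensus.STPPVosperSlackTwoLawABQ

/-!
# ω-census (abelian STPP census): ℤ₅₉ leaf L2 = {(2,2,3),(3,4,2)²} — slack-2 three-block law, case A rows up to dihedral symmetry, part 1 of 3 (kernel computations)

HONEST FRAMING (pub-omega census; verbatim): lottery ticket; floor = certified bounds/negative ranges.
Census STRUCTURE (seat pub-omega-stpp-2 gen 27 — rows service for the stpp-1 lineage's law, 2026-08-29), family (b2).  Rows for stpp-1 g33's three-block slack-2 law (checker `caseADeadT` of `STPPVosperSlackTwoCheckersT.lean`, dead table `tblZ59L2A` of `…TablesZ59.lean`; family rotated to (C,A,B); block i = a (3,4,2) block read (a,b,c) = (2,3,4), others (3,2,2),(2,3,4), L = 16, z = 14): `dihedralSmaller 59 Q || caseADeadT 59 2 4 16 14 Q tblZ59L2A` over `qShapes 59 3` (dihedral representatives only; stpp-1 g33 mirror 122 247 nodes; farm calibration ≈ 1.2 ms per node).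
Each theorem is ONE `decide +kernel` over one chunk (sized by a python cost mirror to stay under the default-heartbeat ceiling).
Assembly in `STPPVosperSlackTwoRows59L2AAsm.lean`.  Nothing here is progress on `ω`.
-/

namespace Summit.MatrixMultiplication.OmegaCensus.CubeNB.S2

/-- Rows chunk `[0, 1069)`: every entry passes the kernel test. [folklore] -/
theorem rows59L2A_c0 : ((qShapes 59 3 0 1069).all fun Q => dihedralSmaller 59 Q || caseADeadT 59 2 4 16 14 Q tblZ59L2A) = true := by
  decide +kernel

/-- Rows chunk `[1069, 1164)`: every entry passes the kernel test. [folklore] -/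
theorem rows59L2A_c1 : ((qShapes 59 3 1069 1164).all fun Q => dihedralSmaller 59 Q || caseADeadT 59 2 4 16 14 Q tblZ59L2A) = true := by
  decide +kernel

/-- Rows chunk `[1164, 1256)`: every entry passes the kernel test. [folklore] -/
theorem rows59L2A_c2 : ((qShapes 59 3 1164 1256).all fun Q => dihedralSmaller 59 Q || caseADeadT 59 2 4 16 14 Q tblZ59L2A) = true := by
  decide +kernel

/-- Rows chunk `[1256, 1318)`: every entry passes the kernel test. [folklore] -/
theorem rows59L2A_c3 : ((qShapes 59 3 1256 1318).all fun Q => dihedralSmaller 59 Q || caseADeadT 59 2 4 16 14 Q tblZ59L2A) = true := by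
  decide +kernel

/-- Rows chunk `[1318, 1371)`: every entry passes the kernel test. [folklore] -/
theorem rows59L2A_c4 : ((qShapes 59 3 1318 1371).all fun Q => dihedralSmaller 59 Q || caseADeadT 59 2 4 16 14 Q tblZ59L2A) = true := by
  decide +kernel

/-- Rows chunk `[1371, 1423)`: every entry passes the kernel test. [folklore] -/
theorem rows59L2A_c5 : ((qShapes 59 3 1371 1423).all fun Q => dihedralSmaller 59 Q || caseADeadT 59 2 4 16 14 Q tblZ59L2A) = true := by
  decide +kernel

end Summit.MatrixMultiplication.OmegaCensus.CubeNB.S2
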